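/-
COR-CM (cell pub-hodgecm2, stage 2 of the Hodge ladder) — count-neutral KERNEL COMBINATORICS «normal form of a 2-group with a cyclic subgroup of
index two» (seat prover-pub-hodgecm2-b23-g50-0, binder prover b23, gen 50; own census lane INDEX-TWO CYCLIC 2-GROUPS, claim HOME/INBOX.md l.23042).
Theorems only (elementary group theory, Mathlib only); no definition, no `decide`, no certificate, no named fact, no `sorry`.
`Interfaces.lean` (C1), every E term, B01, `Transposition/*`, `PortJoin/*`, `D2Bridge/*` untouched.
HONEST FRAMING: `HC_CM` is NOT proved, here or anywhere in the tree; nothing here is a period, a count of record or a headline.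
T5: n/a-class (hypothesis binders: `orderOf u = 2n`, `n = 2^a`, `(zpowers u).index = 2`, `w ∉ zpowers u`, equations; checker: self, 2026-08-25).
-/
import Mathlib.GroupTheory.IndexNormal
import Mathlib.GroupTheory.SpecificGroups.Cyclic
import Mathlib.Data.Int.GCD
import HarnessLib

/-!
# The normal form of a finite group with a cyclic subgroup of index two of 2-power order

Let `u ∈ G` have order `2n = 2^{a+1}` with `[G : ⟨u⟩] = 2` (so `|G| = 2^{a+2}` and `⟨u⟩` is a cyclic maximal subgroup).  For any `w ∉ ⟨u⟩`
write `w u w⁻¹ = uʳ` and `w² = uʲ` (`⟨u⟩` is normal of index two); then `r² ≡ 1`, `r j ≡ j (mod 2n)` and **`(w uⁱ)² = u^{j + (r+1) i}`**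
(`coset_mul_self`).  The classification of such groups (cyclic, `ℤ/2n × ℤ/2`, dihedral, generalised quaternion, semidihedral, modular — Burnside)
is NOT needed by the face census; what it needs is the following classification-free

**TRICHOTOMY** (`exists_involution_or_isCyclic_or_quaternion`): EITHER some element outside `⟨u⟩` is an involution (the split case: `G` carries an
index-two cyclic datum of `Census/IndexTwoCyclicSquareTwist.lean`), OR `G` is cyclic, OR some `w ∉ ⟨u⟩` satisfies the quaternion relations
`w² = uⁿ`, `w u w⁻¹ = u⁻¹` (then every element outside `⟨u⟩` squares to `uⁿ` and `G ≅ Q_{4n}`, `Census/IndexTwoCyclicQuaternion.lean`).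

The proof is a 2-adic pinch on the exponents (`pinch`): if no coset element is an involution and `j` is even, then `r ≡ 3 (mod 4)` (for
`r ≡ 1 (mod 4)` the congruence `j + (r+1) i ≡ 0` is solvable since `(r+1)/2` is odd), so `(r−1)/2` is odd and `2n ∣ (r−1)(r+1)` forces `n ∣ r+1`,
`r j ≡ j` forces `n ∣ j`, whence `j = n` (`j = 0` would be an involution) and `r + 1 = 2n` (`r + 1 = n` would make `w u` an involution).

* §1 exponents of a coset element and the square formula; §2 the arithmetic pinch; §3 the trichotomy; §4 small complements used by the census
  capstone (`eq_pow_of_mem_zpowers_of_mul_self`: an involution of `⟨u⟩` is `uⁿ`; `orderOf_eq_of_card`: `|G| = 2^k`, `[G:⟨u⟩] = 2 ⟹ ord u = 2^{k−1}`).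

## References
* [Rotman1995] J. J. Rotman, *An Introduction to the Theory of Groups*, 4th ed., GTM 148, Springer 1995, Thm. 5.46 (context only; not used).
-/

namespace Summit.HodgeConjecture.CorCM.Census.IndexTwoCyclic

variable {G : Type*} [Group G]

/-! ## §1 Exponents of a coset element -/

/-- An element of `⟨u⟩` (`G` finite) is `uⁱ` with `i < ord u`. [folklore] -/
theorem exists_pow_eq_of_mem_zpowers [Finite G] {u x : G} (hx : x ∈ Subgroup.zpowers u) : ∃ i : ℕ, i < orderOf u ∧ u ^ i = x := by
  classical
  rw [mem_zpowers_iff_mem_range_orderOf, Finset.mem_image] at hx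
  obtain ⟨i, hi, rfl⟩ := hx
  exact ⟨i, Finset.mem_range.mp hi, rfl⟩

/-- Modulo a subgroup of index two every square lies in the subgroup. [folklore] -/
theorem mul_self_mem_of_index_two {H : Subgroup G} (hH : H.index = 2) (w : G) : w * w ∈ H := by
  rw [Subgroup.mul_mem_iff_of_index_two hH]

/-- A subgroup of index two is normal: `w u w⁻¹ ∈ ⟨u⟩`. [folklore] -/
theorem conj_mem_zpowers_of_index_two {u : G} (hindex : (Subgroup.zpowers u).index = 2) (w : G) :
    w * u * w⁻¹ ∈ Subgroup.zpowers u :=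
  (Subgroup.normal_of_index_eq_two hindex).conj_mem u (Subgroup.mem_zpowers u) w

/-- A subgroup of index two is proper: some element lies outside. [folklore] -/
theorem exists_notMem_of_index_two {H : Subgroup G} (hH : H.index = 2) : ∃ w : G, w ∉ H := by
  by_contra h
  push Not at h
  have h1 : H.index = 1 := Subgroup.index_eq_one.mpr ((Subgroup.eq_top_iff' H).mpr h)
  omega

/-- `w uⁱ w⁻¹ = u^{r i}` once `w u w⁻¹ = uʳ`. [folklore] -/
theorem conj_pow_eq {u w : G} {r : ℕ} (hwu : w * u * w⁻¹ = u ^ r) (i : ℕ) : w * u ^ i * w⁻¹ = u ^ (r * i) := by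
  rw [pow_mul, ← hwu, ← MulAut.conj_apply, map_pow, MulAut.conj_apply]

/-- `w uⁱ = u^{r i} w` once `w u w⁻¹ = uʳ`. [folklore] -/
theorem mul_pow_eq {u w : G} {r : ℕ} (hwu : w * u * w⁻¹ = u ^ r) (i : ℕ) : w * u ^ i = u ^ (r * i) * w := by
  rw [← conj_pow_eq hwu i, inv_mul_cancel_right]

/-- **`u^{r²} = u`**: conjugating twice by `w` is conjugating by `w² ∈ ⟨u⟩`, which is trivial on `⟨u⟩`. [folklore] -/
theorem pow_r_mul_r_eq {u w : G} {r j : ℕ} (hwu : w * u * w⁻¹ = u ^ r) (hww : w * w = u ^ j) : u ^ (r * r) = u := by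
  have h1 : w * (w * u * w⁻¹) * w⁻¹ = u ^ (r * r) := by rw [hwu, conj_pow_eq hwu r]
  have h2 : w * (w * u * w⁻¹) * w⁻¹ = u := by
    have e : w * (w * u * w⁻¹) * w⁻¹ = (w * w) * u * (w * w)⁻¹ := by group
    rw [e, hww, ← pow_succ, pow_succ', mul_inv_cancel_right]
  rw [← h1, h2]

/-- **`u^{r j} = uʲ`**: `w` commutes with `w² = uʲ`. [folklore] -/
theorem pow_r_mul_j_eq {u w : G} {r j : ℕ} (hwu : w * u * w⁻¹ = u ^ r) (hww : w * w = u ^ j) : u ^ (r * j) = u ^ j := by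
  rw [← conj_pow_eq hwu j, ← hww, mul_assoc, mul_inv_cancel_right]

/-- **THE SQUARE OF A COSET ELEMENT**: `(w uⁱ)² = u^{j + (r+1) i}`. [folklore] -/
theorem coset_mul_self {u w : G} {r j : ℕ} (hwu : w * u * w⁻¹ = u ^ r) (hww : w * w = u ^ j) (i : ℕ) :
    (w * u ^ i) * (w * u ^ i) = u ^ (j + (r + 1) * i) := by
  have e : (w * u ^ i) * (w * u ^ i) = (w * u ^ i * w⁻¹) * (w * w) * u ^ i := by group
  rw [e, conj_pow_eq hwu i, hww, ← pow_add, ← pow_add]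
  congr 1
  ring

/-! ## §2 The arithmetic pinch -/

/-- If `r ≡ 1 (mod 4)` and `j` is even then `j + (r+1) i ≡ 0 (mod 2n)` is solvable at every 2-power level `n = 2ᵃ`
(`(r+1)/2` is odd, hence invertible mod `n`). [folklore] -/
theorem exists_dvd_of_mod_four_eq_one {n a r j : ℕ} (ha : n = 2 ^ a) (hr : r % 4 = 1) (hj : Even j) :
    ∃ i : ℕ, 2 * n ∣ j + (r + 1) * i := by
  obtain ⟨j', rfl⟩ := hj
  have hn0 : n ≠ 0 := by rw [ha]; positivity
  -- `r + 1 = 2m` with `m` odd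
  obtain ⟨m, hm, hm2⟩ : ∃ m, r + 1 = 2 * m ∧ m % 2 = 1 := ⟨(r + 1) / 2, by omega, by omega⟩
  have hcop : Nat.Coprime m n := by
    rw [ha]
    exact Nat.Coprime.pow_right a ((Nat.prime_two.coprime_iff_not_dvd.mpr (by omega)).symm)
  obtain ⟨i, -, hi⟩ := Nat.exists_mul_mod_eq_of_coprime ((n - 1) * j') hcop hn0
  refine ⟨i, ?_⟩
  have hmod : j' + m * i ≡ j' + (n - 1) * j' [MOD n] := Nat.ModEq.add_left j' hi
  have hsum : j' + (n - 1) * j' = n * j' := by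
    obtain ⟨k, rfl⟩ : ∃ k, n = k + 1 := ⟨n - 1, by omega⟩
    rw [Nat.add_sub_cancel]
    ring
  rw [hsum] at hmod
  have hdvd : n ∣ j' + m * i := Nat.modEq_zero_iff_dvd.mp (hmod.trans (Nat.modEq_zero_iff_dvd.mpr (dvd_mul_right n j')))
  have e : j' + j' + (r + 1) * i = 2 * (j' + m * i) := by rw [hm]; ring
  rw [e]
  exact Nat.mul_dvd_mul_left 2 hdvd

/-- A positive multiple of `n` that is at most `2n` is `n` or `2n`. [folklore] -/
theorem eq_or_eq_of_dvd_of_le {n x : ℕ} (hdvd : n ∣ x) (h0 : x ≠ 0) (hle : x ≤ 2 * n) : x = n ∨ x = 2 * n := by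
  obtain ⟨q, rfl⟩ := hdvd
  have hn0 : n ≠ 0 := by rintro rfl; exact h0 (zero_mul q)
  have hq : q ≤ 2 := Nat.le_of_mul_le_mul_left (by rwa [mul_comm 2 n] at hle) (Nat.pos_of_ne_zero hn0)
  interval_cases q
  · exact absurd (mul_zero n) h0
  · exact Or.inl (mul_one n)
  · exact Or.inr (mul_comm n 2)

/-- **THE 2-ADIC PINCH.**  At 2-power level `n = 2ᵃ`, for reduced exponents `r, j < 2n`: if `r² ≡ 1`, `r j ≡ j (mod 2n)`, `j` is even and
`j + (r+1) i ≡ 0 (mod 2n)` has NO solution `i`, then `r + 1 = 2n` and `j = n` — the quaternion exponents. [folklore] -/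
theorem pinch {n a r j : ℕ} (ha : n = 2 ^ a) (hr : r < 2 * n) (hjlt : j < 2 * n) (hrr : r * r ≡ 1 [MOD 2 * n])
    (hrj : r * j ≡ j [MOD 2 * n]) (hj : Even j) (hno : ∀ i : ℕ, ¬ 2 * n ∣ j + (r + 1) * i) : r + 1 = 2 * n ∧ j = n := by
  have hn0 : n ≠ 0 := by rw [ha]; positivity
  -- `r` is odd
  have hsq : r * r % 2 = 1 := Nat.ModEq.of_mul_right n hrr
  have hodd : Odd r := (Nat.odd_mul.mp (Nat.odd_iff.mpr hsq)).1
  obtain ⟨k, rfl⟩ := hodd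
  rcases Nat.even_or_odd k with ⟨l, rfl⟩ | ⟨l, rfl⟩
  · -- `r = 4l + 1`: the congruence is solvable, contradiction
    obtain ⟨i, hi⟩ := exists_dvd_of_mod_four_eq_one (r := 2 * (l + l) + 1) (j := j) ha (by omega) hj
    exact absurd hi (hno i)
  · -- `r = 4l + 3 = 2m + 1` with `m = 2l + 1` odd
    set m := 2 * l + 1 with hm
    have hcop : Nat.Coprime n m := by
      rw [ha]
      exact Nat.Coprime.pow_left a (Nat.prime_two.coprime_iff_not_dvd.mpr (by omega))
    -- `2n ∣ r² − 1 = 2·(m (r+1))` ⟹ `n ∣ r + 1`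
    have e1 : (2 * m + 1) * (2 * m + 1) = 1 + 2 * (m * (2 * m + 1 + 1)) := by ring
    have h1 : 2 * n ∣ 2 * (m * (2 * m + 1 + 1)) := by
      have h := (Nat.modEq_iff_dvd' (by omega)).mp hrr.symm
      rwa [e1, Nat.add_sub_cancel_left] at h
    have hn1 : n ∣ 2 * m + 1 + 1 := hcop.dvd_of_dvd_mul_left (Nat.dvd_of_mul_dvd_mul_left (by norm_num) h1)
    -- `2n ∣ r j − j = 2·(m j)` ⟹ `n ∣ j` ⟹ `j = n` (`j = 0` would make `w` an involution)
    have e2 : (2 * m + 1) * j = j + 2 * (m * j) := by ring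
    have h2 : 2 * n ∣ 2 * (m * j) := by
      have h := (Nat.modEq_iff_dvd' (by omega)).mp hrj.symm
      rwa [e2, Nat.add_sub_cancel_left] at h
    have hnj : n ∣ j := hcop.dvd_of_dvd_mul_left (Nat.dvd_of_mul_dvd_mul_left (by norm_num) h2)
    have hjn : j = n := by
      by_cases hj0 : j = 0
      · exact absurd ⟨0, by rw [hj0]; simp⟩ (hno 0)
      · rcases eq_or_eq_of_dvd_of_le hnj hj0 hjlt.le with h | h
        · exact h
        · omega
    refine ⟨?_, hjn⟩
    -- `n ∣ r + 1 ≤ 2n`: `r + 1 = n` would make `w u` an involution (`i = 1`)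
    rcases eq_or_eq_of_dvd_of_le hn1 (by omega) (by omega) with h | h
    · exfalso
      refine hno 1 ⟨1, ?_⟩
      rw [hjn, mul_one, h]
      ring
    · exact h

/-! ## §3 The trichotomy -/

/-- If the square of some `w ∉ ⟨u⟩` generates `⟨u⟩` (`[G : ⟨u⟩] = 2`), then `G = ⟨w⟩` is cyclic. [folklore] -/
theorem isCyclic_of_mul_self_eq_pow [Finite G] {u w : G} {j : ℕ} (hindex : (Subgroup.zpowers u).index = 2)
    (hw : w ∉ Subgroup.zpowers u) (hww : w * w = u ^ j) (hj : j.Coprime (orderOf u)) : IsCyclic G := by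
  obtain ⟨m, hm⟩ := exists_pow_eq_self_of_coprime hj
  have hle : Subgroup.zpowers u ≤ Subgroup.zpowers w := by
    rw [Subgroup.zpowers_le, ← hm, ← hww, ← pow_two, ← pow_mul]
    exact Subgroup.pow_mem _ (Subgroup.mem_zpowers w) _
  have hdvd : (Subgroup.zpowers w).index ∣ 2 := hindex ▸ Subgroup.index_dvd_of_le hle
  rcases (Nat.dvd_prime Nat.prime_two).mp hdvd with h1 | h2
  · exact isCyclic_iff_exists_zpowers_eq_top.mpr ⟨w, Subgroup.index_eq_one.mp h1⟩
  · exfalso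
    have hcard : Nat.card (Subgroup.zpowers w) ≤ Nat.card (Subgroup.zpowers u) := by
      have h := (Subgroup.zpowers u).card_mul_index
      have h' := (Subgroup.zpowers w).card_mul_index
      rw [hindex] at h
      rw [h2] at h'
      omega
    have heq := Subgroup.eq_of_le_of_card_ge hle hcard
    apply hw
    rw [heq]
    exact Subgroup.mem_zpowers w

/-- **THE TRICHOTOMY.**  Let `u ∈ G` have order `2n = 2^{a+1}` and `[G : ⟨u⟩] = 2`.  Then EITHER some element outside `⟨u⟩` is an involution,
OR `G` is cyclic, OR some `w ∉ ⟨u⟩` satisfies the quaternion relations `w² = uⁿ`, `w u w⁻¹ = u⁻¹`.  (No classification theorem is used.)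
[folklore] -/
theorem exists_involution_or_isCyclic_or_quaternion [Finite G] (u : G) {n a : ℕ} (ha : n = 2 ^ a) (hord : orderOf u = 2 * n)
    (hindex : (Subgroup.zpowers u).index = 2) :
    (∃ w : G, w ∉ Subgroup.zpowers u ∧ w * w = 1) ∨ IsCyclic G ∨
      (∃ w : G, w ∉ Subgroup.zpowers u ∧ w * w = u ^ n ∧ w * u * w⁻¹ = u⁻¹) := by
  by_cases hinv : ∃ w : G, w ∉ Subgroup.zpowers u ∧ w * w = 1
  · exact Or.inl hinv
  push Not at hinv
  obtain ⟨w, hw⟩ := exists_notMem_of_index_two hindex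
  obtain ⟨r, hr, hwu⟩ := exists_pow_eq_of_mem_zpowers (conj_mem_zpowers_of_index_two hindex w)
  obtain ⟨j, hj, hww⟩ := exists_pow_eq_of_mem_zpowers (mul_self_mem_of_index_two hindex w)
  rw [hord] at hr hj
  by_cases hcop : j.Coprime (orderOf u)
  · exact Or.inr (Or.inl (isCyclic_of_mul_self_eq_pow hindex hw hww.symm hcop))
  have hn0 : n ≠ 0 := by rw [ha]; positivity
  -- `j` is even (an odd `j` is prime to `2n = 2^{a+1}`)
  have hjeven : Even j := by
    by_contra hodd
    rw [Nat.not_even_iff_odd] at hodd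
    apply hcop
    rw [hord, ha, ← pow_succ']
    exact Nat.Coprime.pow_right _ (Nat.prime_two.coprime_iff_not_dvd.mpr hodd.not_two_dvd_nat).symm
  have hrr : r * r ≡ 1 [MOD 2 * n] := by
    rw [← hord, ← pow_eq_pow_iff_modEq, pow_one]
    exact pow_r_mul_r_eq hwu.symm hww.symm
  have hrj : r * j ≡ j [MOD 2 * n] := by
    rw [← hord, ← pow_eq_pow_iff_modEq]
    exact pow_r_mul_j_eq hwu.symm hww.symm
  have hno : ∀ i : ℕ, ¬ 2 * n ∣ j + (r + 1) * i := by
    intro i hi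
    -- `w uⁱ ∉ ⟨u⟩` (seat b04ʼs `AbelianOddPart.mul_pow_not_mem_zpowers`, inlined to keep this file Mathlib-only)
    apply hinv (w * u ^ i) (fun h => hw ((Subgroup.mul_mem_cancel_right _ (Subgroup.pow_mem _ (Subgroup.mem_zpowers u) i)).mp h))
    rw [coset_mul_self hwu.symm hww.symm, ← orderOf_dvd_iff_pow_eq_one, hord]
    exact hi
  obtain ⟨hr1, hjn⟩ := pinch ha hr hj hrr hrj hjeven hno
  refine Or.inr (Or.inr ⟨w, hw, by rw [← hww, hjn], ?_⟩)
  rw [← hwu]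
  apply eq_inv_of_mul_eq_one_left
  rw [← pow_succ, hr1, ← hord, pow_orderOf_eq_one]

/-- In the quaternion case EVERY element outside `⟨u⟩` squares to `uⁿ` (`ord u = 2n`). [folklore] -/
theorem mul_self_eq_of_quaternion {u w x : G} {n : ℕ} (hord : orderOf u = 2 * n) (hindex : (Subgroup.zpowers u).index = 2)
    (hw : w ∉ Subgroup.zpowers u) (hww : w * w = u ^ n) (hwu : w * u * w⁻¹ = u⁻¹) (hx : x ∉ Subgroup.zpowers u) [Finite G] :
    x * x = u ^ n := by
  -- `x = w uⁱ`: `w⁻¹ x ∈ ⟨u⟩`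
  have hwx : w⁻¹ * x ∈ Subgroup.zpowers u := by
    rw [Subgroup.mul_mem_iff_of_index_two hindex, Subgroup.inv_mem_iff]
    exact ⟨fun h => absurd h hw, fun h => absurd h hx⟩
  obtain ⟨i, -, hi⟩ := exists_pow_eq_of_mem_zpowers hwx
  have hxe : x = w * u ^ i := by rw [hi, mul_inv_cancel_left]
  have hwu' : w * u * w⁻¹ = u ^ (2 * n - 1) := by
    rw [hwu]
    apply inv_eq_of_mul_eq_one_right
    rw [← pow_succ', Nat.sub_add_cancel (by have := orderOf_pos u; omega), ← hord, pow_orderOf_eq_one]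
  rw [hxe, coset_mul_self hwu' hww i, Nat.sub_add_cancel (by have := orderOf_pos u; omega), pow_add, pow_mul, ← hord,
    pow_orderOf_eq_one, one_pow, mul_one]

/-! ## §4 Complements for the census capstone -/

/-- **An involution of `⟨u⟩` is `uⁿ`** (`ord u = 2n`). [folklore] -/
theorem eq_pow_of_mem_zpowers_of_mul_self [Finite G] {u c : G} {n : ℕ} (hord : orderOf u = 2 * n) (hc : c ∈ Subgroup.zpowers u)
    (hc2 : c * c = 1) (hc1 : c ≠ 1) : c = u ^ n := by
  obtain ⟨i, hi, rfl⟩ := exists_pow_eq_of_mem_zpowers hc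
  rw [hord] at hi
  have h2 : 2 * n ∣ i + i := by
    rw [← hord, orderOf_dvd_iff_pow_eq_one, pow_add]
    exact hc2
  have hi0 : i ≠ 0 := by
    rintro rfl
    exact hc1 (pow_zero u)
  rcases eq_or_eq_of_dvd_of_le h2 (by omega) (by omega) with h | h
  · rw [show i = n by omega]
  · omega

/-- `orderOf u > 0` bookkeeping: `|G| = 2ᵏ` with `[G : ⟨u⟩] = 2` and `k ≥ 2` ⟹ `ord u = 2 · 2^{k−2}`. [folklore] -/
theorem orderOf_eq_of_card [Finite G] {u : G} {k : ℕ} (hcard : Nat.card G = 2 ^ k) (hk : 2 ≤ k)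
    (hindex : (Subgroup.zpowers u).index = 2) : orderOf u = 2 * 2 ^ (k - 2) := by
  have h := (Subgroup.zpowers u).card_mul_index
  rw [hindex, hcard, Nat.card_zpowers] at h
  obtain ⟨k', rfl⟩ : ∃ k', k = k' + 2 := ⟨k - 2, by omega⟩
  rw [Nat.add_sub_cancel, ← pow_succ']
  rw [pow_succ] at h
  exact Nat.eq_of_mul_eq_mul_right (by norm_num) h

end Summit.HodgeConjecture.CorCM.Census.IndexTwoCyclic
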